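import Summits.BirchSwinnertonDyer.BirchSwinnertonDyer.Theorems.QuadraticBranchSignedControlPlusEtaNonsurjCartanFieldCMAnchor
import Literature.NumberTheory.EllipticCurves.SupersingularDensitySerreTraceProofs
import Literature.NumberTheory.EllipticCurves.CMTorsionGaloisImage
import Mathlib.LinearAlgebra.Trace
import HarnessLib

/-!
# Route `QuadraticBranchSignedControl` (rung K8, cell `bsd-potss`): crux stmt-BirchSwinnertonDyer-19606
# `PlusEtaMainConjectureNonsurj` — FROBENIUS READS THE CARTAN FIELD: `p ∤ a_ℓ(V) ⟹ Frob_ℓ ∈ H_V`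
# (part 3 of the kernel form of FINDING-19606-k8eta-c2-g5 §2; the arithmetic certificate behind «no CM anchor»)

WHAT. Continuation of `…PlusEtaNonsurjCartanField` / `…CartanFieldCMAnchor` (the intrinsic Cartan subgroup
`H_V = ρ̄⁻¹(C_ns(p))` of a row of crux 19606 — the absolute Galois group of the Cartan field `K_V` — and the theorem that a
CM anchor forces `H_V = Γ_K`). This file wires `H_V` to ARITHMETIC DATA of the row through the Frobenius/trace
dictionary of the tree (`WeierstrassCurve.trace_galoisRepTorsion_frobenius_eq`: the trace of an arithmetic Frobenius at a
good `ℓ ≠ p` on `V[p]` is `a_ℓ(V) mod p`):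

* §0 `hasModPImageEqNonsplitCartanNormalizer_of_modPCongruent` — the image `C_ns⁺(p)` is a mod-`p` invariant, so an
  anchor of a row is itself an `X_ns⁺(p)`-curve (`cartanSubgroup_eq_ker_of_cmAnchor_of_row'`: the companion file's row
  theorem with the anchor's image hypothesis discharged).

* §1 `trace_eq_matrix_trace` — in a frame `e`, the `𝔽_p`-linear trace of `σ` on `V[p]` is the trace of its matrix;
  `matrix_mem_nonsplitCartan_of_trace_ne_zero` — the elements of `C_ns⁺(ε)` off `C_ns(ε)` have trace `0`, so a `σ` of
  NON-ZERO trace lies in the Cartan subgroup; `centralizes_sq_of_trace_ne_zero` (frame-free form).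
* §2 **`centralizes_sq_frob_of_not_dvd_frobeniusTrace`** — on a row (`Im ρ̄_{V,p} = C_ns⁺(p)`, `p ≠ 2`), for every good
  prime `ℓ ≠ p` with `p ∤ a_ℓ(V)`, every arithmetic Frobenius `Frob_ℓ` centralises the squares on `V[p]` — **`Frob_ℓ ∈ H_V`,
  i.e. `ℓ` SPLITS in `K_V`**; contrapositive `dvd_frobeniusTrace_of_frob_not_centralizes_sq`: **`a_ℓ(V) ≡ 0 (mod p)` at
  every good `ℓ` whose Frobenius is outside `H_V`** (every `ℓ` inert in `K_V`: the «signature `a_ℓ mod 5`» by which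
  FINDING g5 computed `K_V` for 336 rows is this theorem).
* §3 **certificate** `not_modPCongruent_of_frob_of_not_dvd_frobeniusTrace` — a good prime `ℓ ≠ p` with `p ∤ a_ℓ(V)`
  whose Frobenius lies OUTSIDE `Γ_K` (`χ(Frob_ℓ) ≠ 1`: `ℓ` inert in the CM field `K`) rules out every CM anchor with CM
  field `K` (image `C_ns⁺(p)`, `√D`-structure `(Ψ, χ)`) — for all models and twists of all CM curves with that field at
  once; row-level form `…_of_row` from the crux's hypotheses.
* §4 **the `√D`-structure from the tree's CM fact BY NAME** `exists_chi_centralizes_sq_iff_of_cmTorsion_cartanImage`: GIVEN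
  the named Literature fact `cmTorsion_cartanImage` (Lang Ch. 10 §4 read on `ℓ`-torsion; hypothesis position), every CM
  curve `A/ℚ` with image `C_ns⁺(p)` at a prime `p > L₀` carries `(Ψ, χ)` as in `…CartanFieldCMAnchor` (`Ψ = φ = [√D]`,
  `Ψ ≠ 0` on `A[p]` because `Ψ² = D` with `p ∤ D`), hence `H_A = ker χ` — the displayed CM input of the companion files
  discharged modulo that one fact (beyond its threshold `L₀`; at `p = 5` the input stays displayed).

HONEST FRAMING (cell `bsd-potss`, run/shared/lean/pub/bsd-potss/; FULL-BSD rank ≤ 1 programme): TOOL THEOREMS ONLY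
(no definition, no named fact, no `sorry`, axioms standard); the CM input `(Ψ, χ)` and the splitting datum
`χ(Frob_ℓ) ≠ 1` stay DISPLAYED. Nothing is booked; crux 19606 stays OPEN; `BSD(W, p)` is claimed for no pair. Seat
`bsd-potss-k8eta-c2` g9 (prover), `--supports stmt-BirchSwinnertonDyer-19606`.

References: [Serre1972] §2.2, §4.5; [Serre1981] §8.1 (238) (trace of Frobenius = `a_ℓ`); [KrausOesterle1992] §3 Prop. 3;
[Lang1987] Ch. 10 §4; S. Frengley, arXiv:2111.05813, Lemma 28 (`K_V` at `p = 5`).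
-/

set_option autoImplicit false
set_option linter.dupNamespace false

noncomputable section

open scoped Classical NumberField

open Matrix Field IsDedekindDomain NumberField WeierstrassCurve Literature.NumberTheory.EllipticCurves
  Literature.NumberTheory.GaloisRepresentations Literature.NumberTheory.SerreUniformity
  Literature.NumberTheory.EllipticCurves.Rank1Residual Rat.HeightOneSpectrum
open Summit.BirchSwinnertonDyer.Rank1Residual.O6 (ModPCongruent)

namespace Summit.BirchSwinnertonDyer.BirchSwinnertonDyer.Theorems.EtaCartanField

variable {p : ℕ} [hp : Fact p.Prime]

/-! ## §0 The image `C_ns⁺(p)` is a mod-`p` invariant -/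

omit hp in
/-- **Congruent curves have the same mod-`p` image**: `Im ρ̄_{V,p} = C_ns⁺(ε)` in the frame `e` transports along a
`Γ_ℚ`-equivariant `f : V[p] ≃+ A[p]` to the frame `e ∘ f⁻¹` of `A[p]` with the SAME matrices. So an anchor `A` of a row
of crux 19606 is itself an `X_ns⁺(p)`-curve, and the hypothesis `HasModPImageEqNonsplitCartanNormalizer A p` of the
anchor theorems is discharged by the row. [folklore] -/
theorem hasModPImageEqNonsplitCartanNormalizer_of_modPCongruent {V A : WeierstrassCurve ℚ}
    (hV : HasModPImageEqNonsplitCartanNormalizer V p) (hVA : ModPCongruent V A p) :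
    HasModPImageEqNonsplitCartanNormalizer A p := by
  obtain ⟨e, ε, hε, himg, hsurj⟩ := hV
  obtain ⟨f, hf⟩ := hVA
  refine ⟨f.symm.trans e, ε, hε, fun σ => ?_, fun M hM => ?_⟩
  · obtain ⟨M, hM, hσ⟩ := himg σ
    refine ⟨M, hM, fun Q => ?_⟩
    have h1 : σ • Q = f (σ • f.symm Q) := by rw [hf, AddEquiv.apply_symm_apply]
    rw [AddEquiv.trans_apply, AddEquiv.trans_apply, h1, AddEquiv.symm_apply_apply, hσ]
  · obtain ⟨σ, hσ⟩ := hsurj M hM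
    refine ⟨σ, fun Q => ?_⟩
    have h1 : σ • Q = f (σ • f.symm Q) := by rw [hf, AddEquiv.apply_symm_apply]
    rw [AddEquiv.trans_apply, AddEquiv.trans_apply, h1, AddEquiv.symm_apply_apply, hσ]

/-- **Row-level CM-anchor theorem without an image hypothesis on the anchor**: on a row of crux 19606 (`p ≥ 5` good,
`a_p = 0`, tower not onto), a congruent curve `A` carrying a `√D`-structure `(Ψ ≠ 0, χ ≠ 1)` forces the Cartan subgroup of
`V` to be `ker χ` (`…CartanFieldCMAnchor.cartanSubgroup_eq_ker_of_cmAnchor_of_row` with `hA` discharged by §0).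
[cite: Lang1987, Ch. 10 §4, Remark] [cite: Serre1972, §4.5] -/
theorem cartanSubgroup_eq_ker_of_cmAnchor_of_row' (V : WeierstrassCurve ℚ) [V.IsElliptic] [V.IsGloballyMinimal]
    (p : ℕ) [Fact p.Prime] (hp5 : 5 ≤ p) (hgood : V.HasGoodReductionAtPrime p) (hap : V.frobeniusTrace p = 0)
    (hns : ¬ ∀ m : ℕ, V.HasSurjectiveModNGaloisRep (p ^ m : ℕ))
    {A : WeierstrassCurve ℚ} (hVA : ModPCongruent V A p)
    (χ : absoluteGaloisGroup ℚ →* ℤˣ) (hχ : ∃ σ : absoluteGaloisGroup ℚ, χ σ ≠ 1)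
    (Ψ : AddMonoid.End (A.geomTorsion p)) (hΨ0 : Ψ ≠ 0)
    (hΨ : ∀ (σ : absoluteGaloisGroup ℚ) (P : A.geomTorsion p), Ψ (σ • P) = ((χ σ : ℤˣ) : ℤ) • σ • Ψ P) :
    ∃ H : Subgroup (absoluteGaloisGroup ℚ), H.index = 2 ∧ H = χ.ker ∧
      ∀ σ : absoluteGaloisGroup ℚ, σ ∈ H ↔
        ∀ (τ : absoluteGaloisGroup ℚ) (P : V.geomTorsion p), σ • ((τ * τ) • P) = (τ * τ) • (σ • P) :=
  cartanSubgroup_eq_ker_of_cmAnchor_of_row V p hp5 hgood hap hns hVA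
    (hasModPImageEqNonsplitCartanNormalizer_of_modPCongruent
      (hasModPImageEqNonsplitCartanNormalizer_of_row V p hp5 hgood hap hns) hVA) χ hχ Ψ hΨ0 hΨ

/-! ## §1 Traces in a frame -/

section Trace

variable {V : WeierstrassCurve ℚ}

/-- **In a frame `e` the `𝔽_p`-linear trace of `σ` on `V[p]` is the trace of its matrix.** [folklore] -/
theorem trace_eq_matrix_trace (e : V.geomTorsion p ≃+ (Fin 2 → ZMod p)) {σ : absoluteGaloisGroup ℚ}
    {M : Matrix (Fin 2) (Fin 2) (ZMod p)} (hσ : ∀ P : V.geomTorsion p, e (σ • P) = M.mulVec (e P)) :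
    letI : Module (ZMod p) (V.geomTorsion p) := AddSubgroup.torsionBy.zmodModule
    LinearMap.trace (ZMod p) (V.geomTorsion p)
        ((galoisRepTorsion V p σ).toAdd.toAddMonoidHom.toZModLinearMap p) = M.trace := by
  letI : Module (ZMod p) (V.geomTorsion p) := AddSubgroup.torsionBy.zmodModule
  let eL : V.geomTorsion p ≃ₗ[ZMod p] (Fin 2 → ZMod p) :=
    LinearEquiv.ofBijective (e.toAddMonoidHom.toZModLinearMap p) ⟨e.injective, e.surjective⟩
  have heL : ∀ Q : V.geomTorsion p, eL Q = e Q := fun _ ↦ rfl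
  have hconj : Matrix.toLin' M =
      eL.conj ((galoisRepTorsion V p σ).toAdd.toAddMonoidHom.toZModLinearMap p) := by
    refine LinearMap.ext fun v ↦ ?_
    obtain ⟨Q, rfl⟩ := eL.surjective v
    rw [LinearEquiv.conj_apply_apply, eL.symm_apply_apply, heL, heL, Matrix.toLin'_apply]
    change M.mulVec (e Q) = e (σ • Q)
    rw [hσ]
  rw [← LinearMap.trace_conj' _ eL, ← hconj, LinearMap.trace_eq_matrix_trace (ZMod p) (Pi.basisFun (ZMod p) (Fin 2)),
    LinearMap.toMatrix_eq_toMatrix', LinearMap.toMatrix'_toLin']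

/-- **Non-zero trace ⟹ Cartan.** The elements of `C_ns⁺(ε)` of the second kind `(c, −εd; d, −c)` have trace `0`; so if
`σ` acts through `M ∈ C_ns⁺(ε)` and its trace on `V[p]` is non-zero, then `M ∈ C_ns(ε)`. [cite: Serre1972, §2.2] -/
theorem matrix_mem_nonsplitCartan_of_trace_ne_zero (e : V.geomTorsion p ≃+ (Fin 2 → ZMod p)) {ε : ZMod p}
    {σ : absoluteGaloisGroup ℚ} {M : Matrix (Fin 2) (Fin 2) (ZMod p)} (hM : M ∈ nonsplitCartanNormalizer ε)
    (hσ : ∀ P : V.geomTorsion p, e (σ • P) = M.mulVec (e P))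
    (htr : letI : Module (ZMod p) (V.geomTorsion p) := AddSubgroup.torsionBy.zmodModule
      LinearMap.trace (ZMod p) (V.geomTorsion p)
        ((galoisRepTorsion V p σ).toAdd.toAddMonoidHom.toZModLinearMap p) ≠ 0) :
    M ∈ nonsplitCartan ε := by
  by_contra hMC
  obtain ⟨c, d, -, rfl⟩ := exists_eq_coset_of_not_mem_nonsplitCartan hM hMC
  apply htr
  rw [trace_eq_matrix_trace e hσ, Matrix.trace_fin_two_of]
  ring

/-- **Frame-free form**: on a row (`Im ρ̄_{V,p} = C_ns⁺(p)`, `p ≠ 2`), a `σ` of non-zero trace on `V[p]` centralises the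
squares, i.e. lies in the Cartan subgroup `H_V`. [cite: Serre1972, §2.2] -/
theorem centralizes_sq_of_trace_ne_zero (hp2 : p ≠ 2) (h : HasModPImageEqNonsplitCartanNormalizer V p)
    {σ : absoluteGaloisGroup ℚ}
    (htr : letI : Module (ZMod p) (V.geomTorsion p) := AddSubgroup.torsionBy.zmodModule
      LinearMap.trace (ZMod p) (V.geomTorsion p)
        ((galoisRepTorsion V p σ).toAdd.toAddMonoidHom.toZModLinearMap p) ≠ 0) :
    ∀ (τ : absoluteGaloisGroup ℚ) (P : V.geomTorsion p), σ • ((τ * τ) • P) = (τ * τ) • (σ • P) := by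
  obtain ⟨e, ε, hε, himg, hsurj⟩ := h
  obtain ⟨M, hM, hσ⟩ := himg σ
  exact (matrix_mem_nonsplitCartan_iff_centralizes_sq hp2 e hε himg hsurj hM hσ).mp
    (matrix_mem_nonsplitCartan_of_trace_ne_zero e hM hσ htr)

end Trace

/-! ## §2 Frobenius at a good prime with `p ∤ a_ℓ` lies in the Cartan subgroup -/

section Frobenius

variable (V : WeierstrassCurve ℚ) [V.IsElliptic] [V.IsGloballyMinimal]

/-- **`p ∤ a_ℓ(V) ⟹ Frob_ℓ ∈ H_V`.** On a row (`Im ρ̄_{V,p} = C_ns⁺(p)`, `p ≠ 2`), let `ℓ ≠ p` be a prime of good reduction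
with `p ∤ a_ℓ(V)`; then every arithmetic Frobenius `σ` at a prime of `ℤ̄` above `ℓ` centralises the squares on `V[p]` —
its trace on `V[p]` is `a_ℓ mod p ≠ 0` (`trace_galoisRepTorsion_frobenius_eq`), and non-zero trace means Cartan. In
words: **`ℓ` splits in the Cartan field `K_V`.** [cite: Serre1981, §8.1 (238)] [cite: Serre1972, §2.2] -/
theorem centralizes_sq_frob_of_not_dvd_frobeniusTrace (hp2 : p ≠ 2) (h : HasModPImageEqNonsplitCartanNormalizer V p)
    (ℓ : ℕ) [Fact ℓ.Prime] (hℓp : ℓ ≠ p) (hgood : V.HasGoodReductionAtPrime ℓ)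
    (ha : ¬ (p : ℤ) ∣ V.frobeniusTrace ℓ) {v : HeightOneSpectrum (𝓞 ℚ)} (hv : (primesEquiv v : ℕ) = ℓ)
    {𝔓 : Ideal (absIntegers (𝓞 ℚ) ℚ)} (h𝔓 : 𝔓 ∈ v.primesAbove) {σ : absoluteGaloisGroup ℚ}
    (hσ : IsArithFrobAt (𝓞 ℚ) σ 𝔓) :
    ∀ (τ : absoluteGaloisGroup ℚ) (P : V.geomTorsion p), σ • ((τ * τ) • P) = (τ * τ) • (σ • P) := by
  refine centralizes_sq_of_trace_ne_zero hp2 h ?_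
  letI : Module (ZMod p) (V.geomTorsion p) := AddSubgroup.torsionBy.zmodModule
  rw [V.trace_galoisRepTorsion_frobenius_eq p hℓp hgood hv h𝔓 hσ]
  exact fun h0 => ha ((ZMod.intCast_zmod_eq_zero_iff_dvd _ p).mp h0)

/-- **Contrapositive: `a_ℓ(V) ≡ 0 (mod p)` at every good `ℓ ≠ p` whose Frobenius is outside `H_V`** (every `ℓ` inert in
the Cartan field) — the «signature `a_ℓ mod p`» which determines `K_V` numerically (FINDING-19606-k8eta-c2-g5: 336 rows at
`p = 5`, `K_V = ℚ(√−(8t² − 12t + 7))`). [cite: Serre1981, §8.1 (238)] [cite: Serre1972, §2.2] -/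
theorem dvd_frobeniusTrace_of_frob_not_centralizes_sq (hp2 : p ≠ 2) (h : HasModPImageEqNonsplitCartanNormalizer V p)
    (ℓ : ℕ) [Fact ℓ.Prime] (hℓp : ℓ ≠ p) (hgood : V.HasGoodReductionAtPrime ℓ)
    {v : HeightOneSpectrum (𝓞 ℚ)} (hv : (primesEquiv v : ℕ) = ℓ)
    {𝔓 : Ideal (absIntegers (𝓞 ℚ) ℚ)} (h𝔓 : 𝔓 ∈ v.primesAbove) {σ : absoluteGaloisGroup ℚ}
    (hσ : IsArithFrobAt (𝓞 ℚ) σ 𝔓)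
    (hnot : ¬ ∀ (τ : absoluteGaloisGroup ℚ) (P : V.geomTorsion p), σ • ((τ * τ) • P) = (τ * τ) • (σ • P)) :
    (p : ℤ) ∣ V.frobeniusTrace ℓ := by
  by_contra ha
  exact hnot (centralizes_sq_frob_of_not_dvd_frobeniusTrace V hp2 h ℓ hℓp hgood ha hv h𝔓 hσ)

/-! ## §3 The arithmetic certificate «no CM anchor with CM field `K`» -/

/-- **Certificate.** On a row (`Im ρ̄_{V,p} = C_ns⁺(p)`, `p ≠ 2`): a good prime `ℓ ≠ p` with `p ∤ a_ℓ(V)` and an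
arithmetic Frobenius `Frob_ℓ` with `χ(Frob_ℓ) ≠ 1` — `ℓ` INERT in the CM field `K = ℚ(√D)` cut out by `χ` — rule out
every anchor `A` with image `C_ns⁺(p)` and a `√D`-structure `(Ψ ≠ 0, χ)`: `¬ (V[p] ≅ A[p])`. (`Frob_ℓ ∈ H_V` by §2, while
`H_V = Γ_K = ker χ` for any such anchor, `…CartanFieldCMAnchor`.) [cite: Serre1972, §4.5] [cite: Lang1987, Ch. 10 §4] -/
theorem not_modPCongruent_of_frob_of_not_dvd_frobeniusTrace (hp2 : p ≠ 2)
    (h : HasModPImageEqNonsplitCartanNormalizer V p) (ℓ : ℕ) [Fact ℓ.Prime] (hℓp : ℓ ≠ p)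
    (hgood : V.HasGoodReductionAtPrime ℓ) (ha : ¬ (p : ℤ) ∣ V.frobeniusTrace ℓ)
    {v : HeightOneSpectrum (𝓞 ℚ)} (hv : (primesEquiv v : ℕ) = ℓ)
    {𝔓 : Ideal (absIntegers (𝓞 ℚ) ℚ)} (h𝔓 : 𝔓 ∈ v.primesAbove) {σ : absoluteGaloisGroup ℚ}
    (hσ : IsArithFrobAt (𝓞 ℚ) σ 𝔓)
    {A : WeierstrassCurve ℚ} (hA : HasModPImageEqNonsplitCartanNormalizer A p)
    (χ : absoluteGaloisGroup ℚ →* ℤˣ) (Ψ : AddMonoid.End (A.geomTorsion p)) (hΨ0 : Ψ ≠ 0)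
    (hΨ : ∀ (σ : absoluteGaloisGroup ℚ) (P : A.geomTorsion p), Ψ (σ • P) = ((χ σ : ℤˣ) : ℤ) • σ • Ψ P)
    (hχσ : χ σ ≠ 1) : ¬ ModPCongruent V A p :=
  not_modPCongruent_of_centralizes_sq_of_chi_ne_one hp2 hA χ Ψ hΨ0 hΨ
    (centralizes_sq_frob_of_not_dvd_frobeniusTrace V hp2 h ℓ hℓp hgood ha hv h𝔓 hσ) hχσ

/-- **Row-level form** (hypotheses of the crux: `p ≥ 5` good with `a_p = 0`, `p`-adic tower not onto): a good prime
`ℓ ≠ p` with `p ∤ a_ℓ(V)` and `χ(Frob_ℓ) ≠ 1` excludes every CM anchor with the `√D`-structure `(Ψ, χ)`.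
[cite: Serre1972, §4.5] [cite: Lang1987, Ch. 10 §4] -/
theorem not_modPCongruent_of_frob_of_not_dvd_frobeniusTrace_of_row (p : ℕ) [Fact p.Prime] (hp5 : 5 ≤ p)
    (hgood : V.HasGoodReductionAtPrime p) (hap : V.frobeniusTrace p = 0)
    (hns : ¬ ∀ m : ℕ, V.HasSurjectiveModNGaloisRep (p ^ m : ℕ)) (ℓ : ℕ) [Fact ℓ.Prime] (hℓp : ℓ ≠ p)
    (hgoodℓ : V.HasGoodReductionAtPrime ℓ) (ha : ¬ (p : ℤ) ∣ V.frobeniusTrace ℓ)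
    {v : HeightOneSpectrum (𝓞 ℚ)} (hv : (primesEquiv v : ℕ) = ℓ)
    {𝔓 : Ideal (absIntegers (𝓞 ℚ) ℚ)} (h𝔓 : 𝔓 ∈ v.primesAbove) {σ : absoluteGaloisGroup ℚ}
    (hσ : IsArithFrobAt (𝓞 ℚ) σ 𝔓)
    {A : WeierstrassCurve ℚ} (hA : HasModPImageEqNonsplitCartanNormalizer A p)
    (χ : absoluteGaloisGroup ℚ →* ℤˣ) (Ψ : AddMonoid.End (A.geomTorsion p)) (hΨ0 : Ψ ≠ 0)
    (hΨ : ∀ (σ : absoluteGaloisGroup ℚ) (P : A.geomTorsion p), Ψ (σ • P) = ((χ σ : ℤˣ) : ℤ) • σ • Ψ P)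
    (hχσ : χ σ ≠ 1) : ¬ ModPCongruent V A p :=
  not_modPCongruent_of_frob_of_not_dvd_frobeniusTrace V (by omega)
    (hasModPImageEqNonsplitCartanNormalizer_of_row V p hp5 hgood hap hns) ℓ hℓp hgoodℓ ha hv h𝔓 hσ hA χ Ψ hΨ0
    hΨ hχσ

end Frobenius

/-! ## §4 The `√D`-structure from the tree's CM fact, by name -/

/-- **The CM input BY NAME.** GIVEN the named fact `cmTorsion_cartanImage` (the main theorem of complex multiplication
read on `ℓ`-torsion, Lang Ch. 10 §4; hypothesis position): there is `L₀` such that every CM elliptic curve `A/ℚ` whose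
mod-`p` image is `C_ns⁺(p)` at a prime `p > L₀`, `p ≠ 2`, carries a character `χ : Γ_ℚ → {±1}`, `χ ≠ 1` (on paper `χ_K`,
`K` the CM field) with: `σ` centralises the squares on `A[p]` ⟺ `χ(σ) = 1` — i.e. `H_A = ker χ = Γ_K`. The fact's
`φ = [√D]` serves as `Ψ`; `Ψ ≠ 0` on `A[p]` since `φ² = D` with `p ∤ D` and `A[p] ≠ 0`. [cite: Lang1987, Ch. 10 §4, Remark and Thm. 8]
[cite: Serre1972, §4.5] -/
theorem exists_chi_centralizes_sq_iff_of_cmTorsion_cartanImage (hCM : cmTorsion_cartanImage) :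
    ∃ L₀ : ℕ, ∀ (A : WeierstrassCurve ℚ) [A.IsElliptic], A.HasCM → ∀ (p : ℕ) [Fact p.Prime], L₀ < p → p ≠ 2 →
      HasModPImageEqNonsplitCartanNormalizer A p →
      ∃ χ : absoluteGaloisGroup ℚ →* ℤˣ, (∃ σ : absoluteGaloisGroup ℚ, χ σ ≠ 1) ∧
        ∀ σ : absoluteGaloisGroup ℚ,
          (∀ (τ : absoluteGaloisGroup ℚ) (P : A.geomTorsion p), σ • ((τ * τ) • P) = (τ * τ) • (σ • P)) ↔
            χ σ = 1 := by
  obtain ⟨L₀, hL⟩ := hCM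
  refine ⟨L₀, fun A _ hA p _ hpL hp2 himg => ?_⟩
  obtain ⟨φ, D, χ, h1, h2, -, h4, h5, -⟩ := hL A hA p Fact.out hpL
  refine ⟨χ, h4, fun σ => centralizes_sq_iff_chi_eq_one hp2 himg χ h4 φ ?_ h5 σ⟩
  -- `φ ≠ 0`: otherwise `D • P = φ (φ P) = 0` for all `P`, and with `p • P = 0`, `p ∤ D` this forces `A[p] = 0`
  intro hφ
  obtain ⟨e, -, -, -, -⟩ := himg
  have hP : ∃ P : A.geomTorsion p, P ≠ 0 := by
    refine ⟨e.symm (Pi.single 0 1), fun h0 => ?_⟩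
    have h1' := congrArg e h0
    rw [AddEquiv.apply_symm_apply, map_zero] at h1'
    have := congrFun h1' 0
    simp at this
  obtain ⟨P, hP0⟩ := hP
  have hDP : (D : ℤ) • P = 0 := by rw [← h1 P, hφ]; rfl
  letI : Module (ZMod p) (A.geomTorsion p) := AddSubgroup.torsionBy.zmodModule
  have hpP : (p : ℤ) • P = 0 := by
    rw [← Int.cast_smul_eq_zsmul (ZMod p), Int.cast_natCast, ZMod.natCast_self, zero_smul]
  have hpr : Prime (p : ℤ) := Nat.prime_iff_prime_int.mp Fact.out
  have hcop : IsCoprime D (p : ℤ) := ((hpr.irreducible.coprime_iff_not_dvd).mpr h2).symm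
  obtain ⟨u, v, huv⟩ := hcop
  apply hP0
  calc P = (1 : ℤ) • P := (one_zsmul P).symm
    _ = (u * D + v * p) • P := by rw [huv]
    _ = u • (D • P) + v • ((p : ℤ) • P) := by rw [add_zsmul, mul_zsmul, mul_zsmul]
    _ = 0 := by rw [hDP, hpP, zsmul_zero, zsmul_zero, add_zero]

end Summit.BirchSwinnertonDyer.BirchSwinnertonDyer.Theorems.EtaCartanField

end
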